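import Summits.QuantumFields.BalabanUV.Beta.GAN24.ScalarFreeResolvent

/-!
# Row G-an2-4 ∕ (CONV-C), scalar currency — `cosh`-SUPERSOLUTION WEIGHTS FOR THE FREE RESOLVENT `F = (Δ + 1)⁻¹` OF THE SCALAR
# FINE-TORUS LAPLACIAN and the `n`-UNIFORM BLOCK ROWS OF `F^k` AND OF `P_N = Σ_{k<N} F^{k+1}`

NOT IN PRINT; OUR BOOKKEEPING.  Cell `pub-balaban`, G-an2-4 crux team (coordinator ruling e34b3e0c (2)), seat
`b2b-balaban-gan24-formalise-leaf-01` (gen 55), item «(s0) ∕ (K₀ˢ)» (`CLAIMS.log` l.28883 ∕ l.28893 ∕ l.28904 ∕ l.28990), module 2 of the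
line towards the zeroth-order `n`-uniform `ℓ^∞` block bound for NE2's `Gps n M a′ = (LapS + a′•PiS)⁻¹`.  Scalar port of pv15's
`B5G183FreeRowSum` §3–§5 (the VECTOR `Δ_1⁻¹` there; the SCALAR `Δ = B5Action121.LapS (fine n M) n` here), using pv15's `min_principle`,
`weight_stencil`, `weight_centre`, `weight_block_lower` BY NAME and module 1's positivity of `F`.

WHAT IS PROVED (kernel; any `d`, any `n ≥ 1`, any torus `M : Fin (d+1) → ℕ`):
 * §1 **`re_inv_mulVec_weight_le`** (`Re(F W) ≤ λ⁻¹W` for a stencil supersolution `Σ_ν[W(t+e_ν)+W(t−e_ν)] ≤ Λ W(t)`,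
   `λ = 1 + n²(2(d+1) − Λ) > 0`), `re_inv_pow_mulVec_weight_le` (`Re(F^k W) ≤ λ^{−k}W`), `re_resolventPoly_mulVec_weight_le`
   (`Re(P_N W) ≤ Nλ^{−N}W`, `0 < λ ≤ 1`), `resolventPoly_apply_im_re` ∕ `norm_resolventPoly_apply` (entries of `P_N` real `≥ 0`),
   `norm_mulVec_le_re_mulVec` (domination through a nonnegative kernel);
 * §2 `bpt_toT_injective`, **`block_rowsum_le_of_weight`** (generic: nonnegative kernel + `Re(K W_c)(c) ≤ A` for pv15's `cosh`-weight of slope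
   `a` centred at `c = n·x + r` ⟹ `Σ_{r′} ‖K(c, n·x′+r′)‖ ≤ 2A·e^{a(n−1)}·e^{−an|x−x′|_∞}`), `re_inv_pow_mulVec_cosh_le` ∕
   `re_resolventPoly_mulVec_cosh_le` (`Re(F^k W_c)(c) ≤ λ_a^{−k}`, `Re(P_N W_c)(c) ≤ Nλ_a^{−N}`), **`inv_pow_block_rowsum_le`**
   (`Σ_{r′} |F^k(n x + r, n x′ + r′)| ≤ 2λ_a^{−k}e^{a(n−1)}e^{−an|x−x′|_∞}`, `λ_a = 1 − 2(d+1)n²(cosh a − 1) > 0`) and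
   **`resolventPoly_block_rowsum_le`** (`≤ 2Nλ_a^{−N}e^{a(n−1)}e^{−an|x−x′|_∞}`), `|·|_∞ = torusSupNorm M` on `T₁ = Π_μ ℤ/M_μ`.

HONEST SCOPE.  [folklore] discrete maximum principle + Agmon-type multiplicative weight (pv15's method, Hislop–Sigal reading) for the cell's
typed `U = 1` objects; statements and constants OURS and crude; nothing printed by Bałaban is used or asserted.  No `def`, no `def … : Prop`,
no `sorry`.  NOT (CONV-C), NEVER «G-an2-4 closed», NOT NE2 ∕ NE3, NOT D1, NOT BetaPertH, NOT the continuum limit, NOT Clay.  HONEST DEPENDENCY: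
continuum YM on T⁴ ⇐ BetaPertH ∧ nine spine estimates (0/9 proved); BetaPertH ⇐ (D1) ∧ (D4) ∧ CAP+tail; G-an2-4 gates asym, D1 and NE2/3/4.
-/

noncomputable section

open scoped BigOperators ComplexConjugate Matrix
open Finset Complex Matrix

namespace Summit.QuantumFields.BalabanUV.Beta.GAN24.ScalarFreeResolventRows

open Literature.MathematicalPhysics.QuantumFieldTheory.Balaban1983to89
open B5Prop11Plancherel (Tor fine unitVec)
open B5Action121 (LapS)
open B5Block118 (bpt)
open B6LowerBound2153Torus (toT)
open B4TorusKernel.MultiPeriod (circAbs torusSupNorm)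
open B5G183FreeRowSum (min_principle weight_stencil weight_centre weight_block_lower)
open Summit.QuantumFields.BalabanUV.Beta.GAN24.ScalarFreeResolvent

variable {d : ℕ}

/-! ## §1 The supersolution bound `Re (F W) ≤ λ⁻¹ W`, its powers, and the resolvent polynomial `P_N = Σ_{k<N} F^{k+1}` -/

section Weight

variable (n : ℕ) [NeZero n] (M : Fin (d + 1) → ℕ) [hM : ∀ μ, NeZero (M μ)]

/-- SUPERSOLUTION BOUND (maximum principle instead of a Neumann series): if
`Σ_ν [W(t+e_ν) + W(t−e_ν)] ≤ Λ · W(t)` at every site and `λ := 1 + n²(2(d+1) − Λ) > 0`, then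
`Re ((Δ + 1)⁻¹ W)(x) ≤ λ⁻¹ W(x)`. [folklore] -/
theorem re_inv_mulVec_weight_le (W : Tor (fine n M) → ℝ) {Λ : ℝ}
    (hΛ : ∀ t, ∑ ν, (W (t + unitVec (fine n M) ν) + W (t - unitVec (fine n M) ν)) ≤ Λ * W t)
    (hlam : 0 < 1 + (n : ℝ) ^ 2 * (2 * (d + 1) - Λ)) (x : Tor (fine n M)) :
    (((LapS (fine n M) (n : ℂ) + 1)⁻¹ *ᵥ fun j => (W j : ℂ)) x).re ≤ (1 + (n : ℝ) ^ 2 * (2 * (d + 1) - Λ))⁻¹ * W x := by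
  set lam := 1 + (n : ℝ) ^ 2 * (2 * (d + 1) - Λ) with hlam_def
  set u := (LapS (fine n M) (n : ℂ) + 1)⁻¹ *ᵥ fun j : Tor (fine n M) => (W j : ℂ) with hu
  have hB : (LapS (fine n M) (n : ℂ) + 1) *ᵥ u = fun j => (W j : ℂ) := by
    rw [hu, Matrix.mulVec_mulVec, LapSOne_mul_inv, Matrix.one_mulVec]
  have key : ∀ x : Tor (fine n M), (u x).re + (n : ℝ) ^ 2 *
      ∑ ν, (((u x).re - (u (x + unitVec (fine n M) ν)).re) + ((u x).re - (u (x - unitVec (fine n M) ν)).re)) = W x := by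
    intro x
    rw [← re_LapSOne_mulVec, hB]
    simp
  have hWst : ∀ x : Tor (fine n M), lam * W x ≤ W x + (n : ℝ) ^ 2 *
      ∑ ν, ((W x - W (x + unitVec (fine n M) ν)) + (W x - W (x - unitVec (fine n M) ν))) := by
    intro x
    have hs : ∑ ν, ((W x - W (x + unitVec (fine n M) ν)) + (W x - W (x - unitVec (fine n M) ν)))
        = 2 * (d + 1) * W x - ∑ ν, (W (x + unitVec (fine n M) ν) + W (x - unitVec (fine n M) ν)) := by
      rw [Finset.sum_congr rfl fun ν _ => show (W x - W (x + unitVec (fine n M) ν)) + (W x - W (x - unitVec (fine n M) ν))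
          = 2 * W x - (W (x + unitVec (fine n M) ν) + W (x - unitVec (fine n M) ν)) by ring,
        Finset.sum_sub_distrib, Finset.sum_const, Finset.card_univ, Fintype.card_fin, nsmul_eq_mul]
      push_cast
      ring
    rw [hs, hlam_def]
    have h1 := hΛ x
    have hn2 : (0 : ℝ) ≤ (n : ℝ) ^ 2 := by positivity
    nlinarith
  have hv : ∀ x : Tor (fine n M), 0 ≤ lam⁻¹ * W x - (u x).re := by
    refine min_principle (fun ν (x : Tor (fine n M)) => x + unitVec (fine n M) ν) (fun ν x => x - unitVec (fine n M) ν)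
      (C := (n : ℝ) ^ 2) (by positivity) (fun x => lam⁻¹ * W x - (u x).re) (fun x => ?_)
    have e : ∑ ν, ((lam⁻¹ * W x - (u x).re - (lam⁻¹ * W (x + unitVec (fine n M) ν) - (u (x + unitVec (fine n M) ν)).re))
        + (lam⁻¹ * W x - (u x).re - (lam⁻¹ * W (x - unitVec (fine n M) ν) - (u (x - unitVec (fine n M) ν)).re)))
        = lam⁻¹ * ∑ ν, ((W x - W (x + unitVec (fine n M) ν)) + (W x - W (x - unitVec (fine n M) ν)))
          - ∑ ν, (((u x).re - (u (x + unitVec (fine n M) ν)).re) + ((u x).re - (u (x - unitVec (fine n M) ν)).re)) := by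
      rw [Finset.mul_sum, ← Finset.sum_sub_distrib]
      exact Finset.sum_congr rfl fun ν _ => by ring
    rw [e]
    have k := key x
    have hw' : W x ≤ lam⁻¹ * (W x + (n : ℝ) ^ 2 *
        ∑ ν, ((W x - W (x + unitVec (fine n M) ν)) + (W x - W (x - unitVec (fine n M) ν)))) := by
      rw [le_inv_mul_iff₀ hlam]
      exact hWst x
    nlinarith [hw', k]
  have := hv x
  linarith

/-- POWERS: `Re (F^k W)(x) ≤ λ^{−k} W(x)` for a nonnegative supersolution weight. [folklore] -/
theorem re_inv_pow_mulVec_weight_le (W : Tor (fine n M) → ℝ) (hW0 : ∀ t, 0 ≤ W t) {Λ : ℝ}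
    (hΛ : ∀ t, ∑ ν, (W (t + unitVec (fine n M) ν) + W (t - unitVec (fine n M) ν)) ≤ Λ * W t)
    (hlam : 0 < 1 + (n : ℝ) ^ 2 * (2 * (d + 1) - Λ)) (k : ℕ) (x : Tor (fine n M)) :
    ((((LapS (fine n M) (n : ℂ) + 1)⁻¹) ^ k *ᵥ fun j => (W j : ℂ)) x).re
      ≤ ((1 + (n : ℝ) ^ 2 * (2 * (d + 1) - Λ))⁻¹) ^ k * W x := by
  induction k generalizing x with
  | zero => rw [pow_zero, pow_zero, Matrix.one_mulVec, Complex.ofReal_re, one_mul]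
  | succ k ih =>
      set lami := (1 + (n : ℝ) ^ 2 * (2 * (d + 1) - Λ))⁻¹ with hlami_def
      have hreal := fun j => inv_pow_mulVec_ofReal n M W hW0 k j
      have hUre : (((LapS (fine n M) (n : ℂ) + 1)⁻¹) ^ k *ᵥ fun j : Tor (fine n M) => (W j : ℂ))
          = fun j => (((((LapS (fine n M) (n : ℂ) + 1)⁻¹) ^ k *ᵥ fun j : Tor (fine n M) => (W j : ℂ)) j).re : ℂ) := by
        funext j
        apply Complex.ext
        · simp
        · rw [Complex.ofReal_im]; exact (hreal j).1
      rw [pow_succ', ← Matrix.mulVec_mulVec, hUre]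
      have hmono := re_inv_mulVec_ofReal_mono n M
        (fun j => ((((LapS (fine n M) (n : ℂ) + 1)⁻¹) ^ k *ᵥ fun j : Tor (fine n M) => (W j : ℂ)) j).re)
        (fun j => lami ^ k * W j) (fun j => ih j) x
      have hscale : (((LapS (fine n M) (n : ℂ) + 1)⁻¹ *ᵥ fun j : Tor (fine n M) => ((lami ^ k * W j : ℝ) : ℂ)) x).re
          = lami ^ k * (((LapS (fine n M) (n : ℂ) + 1)⁻¹ *ᵥ fun j : Tor (fine n M) => (W j : ℂ)) x).re := by
        have e : (fun j : Tor (fine n M) => ((lami ^ k * W j : ℝ) : ℂ))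
            = ((lami ^ k : ℝ) : ℂ) • fun j : Tor (fine n M) => (W j : ℂ) := by
          funext j
          simp only [Pi.smul_apply, smul_eq_mul]
          push_cast
          ring
        rw [e, Matrix.mulVec_smul, Pi.smul_apply, smul_eq_mul, Complex.re_ofReal_mul]
      rw [hscale] at hmono
      have h1 := re_inv_mulVec_weight_le n M W hΛ hlam x
      have hlami : 0 ≤ lami ^ k := pow_nonneg (inv_nonneg.mpr hlam.le) _
      calc _ ≤ lami ^ k * (((LapS (fine n M) (n : ℂ) + 1)⁻¹ *ᵥ fun j : Tor (fine n M) => (W j : ℂ)) x).re := hmono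
        _ ≤ lami ^ k * (lami * W x) := mul_le_mul_of_nonneg_left h1 hlami
        _ = lami ^ (k + 1) * W x := by ring

/-- THE RESOLVENT POLYNOMIAL `P_N = Σ_{k<N} F^{k+1}` against the weight: `Re (P_N W)(x) ≤ N λ^{−N} W(x)` for `0 < λ ≤ 1`.
[folklore] -/
theorem re_resolventPoly_mulVec_weight_le (W : Tor (fine n M) → ℝ) (hW0 : ∀ t, 0 ≤ W t) {Λ : ℝ}
    (hΛ : ∀ t, ∑ ν, (W (t + unitVec (fine n M) ν) + W (t - unitVec (fine n M) ν)) ≤ Λ * W t)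
    (hlam : 0 < 1 + (n : ℝ) ^ 2 * (2 * (d + 1) - Λ)) (hlam1 : 1 + (n : ℝ) ^ 2 * (2 * (d + 1) - Λ) ≤ 1)
    (Nn : ℕ) (x : Tor (fine n M)) :
    (((∑ k ∈ Finset.range Nn, ((LapS (fine n M) (n : ℂ) + 1)⁻¹) ^ (k + 1)) *ᵥ fun j => (W j : ℂ)) x).re
      ≤ Nn * ((1 + (n : ℝ) ^ 2 * (2 * (d + 1) - Λ))⁻¹) ^ Nn * W x := by
  set lami := (1 + (n : ℝ) ^ 2 * (2 * (d + 1) - Λ))⁻¹ with hlami_def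
  have hlami1 : 1 ≤ lami := (one_le_inv₀ hlam).mpr hlam1
  rw [Matrix.sum_mulVec, Finset.sum_apply, Complex.re_sum]
  calc ∑ k ∈ Finset.range Nn, ((((LapS (fine n M) (n : ℂ) + 1)⁻¹) ^ (k + 1) *ᵥ fun j : Tor (fine n M) => (W j : ℂ)) x).re
      ≤ ∑ _k ∈ Finset.range Nn, lami ^ Nn * W x := by
        refine Finset.sum_le_sum fun k hk => (re_inv_pow_mulVec_weight_le n M W hW0 hΛ hlam (k + 1) x).trans ?_
        exact mul_le_mul_of_nonneg_right (pow_le_pow_right₀ hlami1 (by have := Finset.mem_range.mp hk; omega)) (hW0 x)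
    _ = Nn * lami ^ Nn * W x := by
        rw [Finset.sum_const, Finset.card_range, nsmul_eq_mul]
        ring

/-- ENTRIES of the resolvent polynomial are REAL and NONNEGATIVE. [folklore] -/
theorem resolventPoly_apply_im_re (Nn : ℕ) (x x' : Tor (fine n M)) :
    ((∑ k ∈ Finset.range Nn, ((LapS (fine n M) (n : ℂ) + 1)⁻¹) ^ (k + 1)) x x').im = 0
      ∧ 0 ≤ ((∑ k ∈ Finset.range Nn, ((LapS (fine n M) (n : ℂ) + 1)⁻¹) ^ (k + 1)) x x').re := by
  rw [Matrix.sum_apply, Complex.im_sum, Complex.re_sum]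
  exact ⟨Finset.sum_eq_zero fun k _ => (inv_pow_apply_im_re n M (k + 1) x x').1,
    Finset.sum_nonneg fun k _ => (inv_pow_apply_im_re n M (k + 1) x x').2⟩

/-- hence `‖P_N(x,x′)‖ = Re P_N(x,x′)`. [folklore] -/
theorem norm_resolventPoly_apply (Nn : ℕ) (x x' : Tor (fine n M)) :
    ‖(∑ k ∈ Finset.range Nn, ((LapS (fine n M) (n : ℂ) + 1)⁻¹) ^ (k + 1)) x x'‖
      = ((∑ k ∈ Finset.range Nn, ((LapS (fine n M) (n : ℂ) + 1)⁻¹) ^ (k + 1)) x x').re := by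
  obtain ⟨him, hre⟩ := resolventPoly_apply_im_re n M Nn x x'
  have e : (∑ k ∈ Finset.range Nn, ((LapS (fine n M) (n : ℂ) + 1)⁻¹) ^ (k + 1)) x x'
      = (((∑ k ∈ Finset.range Nn, ((LapS (fine n M) (n : ℂ) + 1)⁻¹) ^ (k + 1)) x x').re : ℂ) :=
    Complex.ext (by simp) (by rw [Complex.ofReal_im]; exact him)
  conv_lhs => rw [e]
  rw [Complex.norm_real, Real.norm_of_nonneg hre]

/-- DOMINATION THROUGH A NONNEGATIVE KERNEL: if `K` has real nonnegative entries and `‖u(x′)‖ ≤ g(x′)` pointwise, then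
`‖(K u)(x)‖ ≤ Re (K g)(x) = Σ_{x′} Re K(x,x′)·g(x′)`. [folklore] -/
theorem norm_mulVec_le_re_mulVec (K : Matrix (Tor (fine n M)) (Tor (fine n M)) ℂ)
    (hK : ∀ x x', (K x x').im = 0 ∧ 0 ≤ (K x x').re) (u : Tor (fine n M) → ℂ) (g : Tor (fine n M) → ℝ)
    (hug : ∀ x', ‖u x'‖ ≤ g x') (x : Tor (fine n M)) :
    ‖(K *ᵥ u) x‖ ≤ ((K *ᵥ fun j => (g j : ℂ)) x).re := by
  have e : ((K *ᵥ fun j => (g j : ℂ)) x).re = ∑ x', (K x x').re * g x' := by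
    simp only [Matrix.mulVec, dotProduct, Complex.re_sum, Complex.re_mul_ofReal]
  rw [e]
  calc ‖(K *ᵥ u) x‖ = ‖∑ x', K x x' * u x'‖ := by simp only [Matrix.mulVec, dotProduct]
    _ ≤ ∑ x', ‖K x x' * u x'‖ := norm_sum_le _ _
    _ ≤ ∑ x', (K x x').re * g x' := Finset.sum_le_sum fun x' _ => by
        rw [norm_mul]
        have hn : ‖K x x'‖ = (K x x').re := by
          obtain ⟨him, hre⟩ := hK x x'
          have e1 : K x x' = ((K x x').re : ℂ) := Complex.ext (by simp) (by rw [Complex.ofReal_im]; exact him)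
          conv_lhs => rw [e1]
          rw [Complex.norm_real, Real.norm_of_nonneg hre]
        rw [hn]
        exact mul_le_mul_of_nonneg_left (hug x') (hK x x').2

end Weight

/-! ## §2 `n`-UNIFORM block row sums of `F^k` and of `P_N` -/

section Block

variable (n : ℕ) [NeZero n] (hn : 1 ≤ n) (M : Fin (d + 1) → ℕ) [hM : ∀ μ, NeZero (M μ)]

/-- the block map `r′ ↦ n·x′ + r′` is injective. [folklore] -/
theorem bpt_toT_injective (x' : Fin (d + 1) → ℤ) :
    Function.Injective (fun r' : Fin (d + 1) → Fin n => bpt n M (toT M x') r') := by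
  intro p q h
  have h1 := B5Blocks16.bpt_injective n M (a₁ := (toT M x', p)) (a₂ := (toT M x', q)) h
  simpa using congrArg Prod.snd h1

include hn in
/-- **GENERIC WEIGHTED BLOCK BOUND**: for a matrix `K` with real nonnegative entries such that `Re (K W_c)(c) ≤ A` for the
`cosh`-weight `W_c` of slope `a ≥ 0` centred at the block point `c = n·x + r` (pv15's weight, `W_c(c) = 1`),
`Σ_{r′} ‖K(c, n·x′ + r′)‖ ≤ 2A·e^{a(n−1)}·e^{−an|x − x′|_∞}`. [folklore] -/
theorem block_rowsum_le_of_weight (K : Matrix (Tor (fine n M)) (Tor (fine n M)) ℂ)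
    (hK : ∀ x x', (K x x').im = 0 ∧ 0 ≤ (K x x').re) {a : ℝ} (ha : 0 ≤ a) {A : ℝ}
    (x x' : Fin (d + 1) → ℤ) (r : Fin (d + 1) → Fin n)
    (hA : ((K *ᵥ fun t => ((∏ μ', Real.cosh (a * (circAbs (fine n M μ')
        ((bpt n M (toT M x) r μ' - t μ' : ZMod (fine n M μ')).val) : ℝ)) : ℝ) : ℂ)) (bpt n M (toT M x) r)).re ≤ A) :
    ∑ r' : Fin (d + 1) → Fin n, ‖K (bpt n M (toT M x) r) (bpt n M (toT M x') r')‖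
      ≤ 2 * A * Real.exp (a * ((n : ℝ) - 1)) * Real.exp (-(a * n * torusSupNorm M (x - x'))) := by
  set c := bpt n M (toT M x) r with hc
  set W : Tor (fine n M) → ℝ := fun t =>
    ∏ μ', Real.cosh (a * (circAbs (fine n M μ') ((c μ' - t μ' : ZMod (fine n M μ')).val) : ℝ)) with hW
  set m := Real.exp (a * ((n : ℝ) * torusSupNorm M (x - x') - ((n : ℝ) - 1))) / 2 with hm
  have hm0 : 0 < m := by positivity
  have hW0 : ∀ t, 0 ≤ W t := fun t => Finset.prod_nonneg fun _ _ => (Real.cosh_pos _).le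
  have hblockW : ∀ r' : Fin (d + 1) → Fin n, m ≤ W (bpt n M (toT M x') r') := fun r' => by
    rw [hm, hW]; exact weight_block_lower n hn M ha x x' r r'
  have hnorm : ∀ x₁ x₂, ‖K x₁ x₂‖ = (K x₁ x₂).re := fun x₁ x₂ => by
    obtain ⟨him, hre⟩ := hK x₁ x₂
    have e1 : K x₁ x₂ = ((K x₁ x₂).re : ℂ) := Complex.ext (by simp) (by rw [Complex.ofReal_im]; exact him)
    conv_lhs => rw [e1]
    rw [Complex.norm_real, Real.norm_of_nonneg hre]
  -- (1) insert the weight `W/m ≥ 1` on the block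
  have step1 : ∑ r' : Fin (d + 1) → Fin n, ‖K c (bpt n M (toT M x') r')‖
      ≤ ∑ r' : Fin (d + 1) → Fin n, (K c (bpt n M (toT M x') r')).re * W (bpt n M (toT M x') r') * m⁻¹ := by
    refine Finset.sum_le_sum fun r' _ => ?_
    rw [hnorm]
    have hre := (hK c (bpt n M (toT M x') r')).2
    have h1 : 1 ≤ W (bpt n M (toT M x') r') * m⁻¹ := by
      rw [← div_eq_mul_inv, le_div_iff₀ hm0, one_mul]; exact hblockW r'
    rw [mul_assoc]
    exact le_mul_of_one_le_right hre h1
  -- (2) extend the sum from the block to the whole torus (all terms are `≥ 0`)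
  have step2 : ∑ r' : Fin (d + 1) → Fin n, (K c (bpt n M (toT M x') r')).re * W (bpt n M (toT M x') r') * m⁻¹
      ≤ (∑ j : Tor (fine n M), (K c j).re * W j) * m⁻¹ := by
    rw [← Finset.sum_mul]
    refine mul_le_mul_of_nonneg_right ?_ (inv_nonneg.mpr hm0.le)
    have hφ := bpt_toT_injective n M x'
    calc ∑ r' : Fin (d + 1) → Fin n, (K c (bpt n M (toT M x') r')).re * W (bpt n M (toT M x') r')
        = ∑ j ∈ Finset.univ.image (fun r' : Fin (d + 1) → Fin n => bpt n M (toT M x') r'), (K c j).re * W j := by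
          rw [Finset.sum_image fun p _ q _ h => hφ h]
      _ ≤ ∑ j, (K c j).re * W j :=
          Finset.sum_le_sum_of_subset_of_nonneg (Finset.subset_univ _) fun j _ _ => mul_nonneg (hK c j).2 (hW0 j)
  -- (3) the full sum is `Re (K W)(c) ≤ A`
  have step3 : ∑ j : Tor (fine n M), (K c j).re * W j ≤ A := by
    have e : ∑ j : Tor (fine n M), (K c j).re * W j = ((K *ᵥ fun j => (W j : ℂ)) c).re := by
      simp only [Matrix.mulVec, dotProduct, Complex.re_sum, Complex.re_mul_ofReal]
    rw [e]
    exact hA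
  -- (4) assemble
  have e3 : A * m⁻¹ = 2 * A * Real.exp (a * ((n : ℝ) - 1)) * Real.exp (-(a * n * torusSupNorm M (x - x'))) := by
    rw [hm, inv_div, div_eq_mul_inv, ← Real.exp_neg,
      show -(a * ((n : ℝ) * torusSupNorm M (x - x') - ((n : ℝ) - 1)))
        = a * ((n : ℝ) - 1) + -(a * n * torusSupNorm M (x - x')) by ring, Real.exp_add]
    ring
  calc ∑ r' : Fin (d + 1) → Fin n, ‖K c (bpt n M (toT M x') r')‖
      ≤ (∑ j : Tor (fine n M), (K c j).re * W j) * m⁻¹ := step1.trans step2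
    _ ≤ A * m⁻¹ := mul_le_mul_of_nonneg_right step3 (inv_nonneg.mpr hm0.le)
    _ = _ := e3

/-- **`Re (F^k W_c)(c) ≤ λ_a^{−k}`** for pv15's `cosh`-weight `W_c` of slope `a` centred at the block point `c = n·x + r`
(`λ_a = 1 − 2(d+1)n²(cosh a − 1) > 0`; `W_c(c) = 1`, `weight_stencil` ∕ `weight_centre` BY NAME). [folklore] -/
theorem re_inv_pow_mulVec_cosh_le {a : ℝ} (hlam : 0 < 1 - 2 * (d + 1) * (n : ℝ) ^ 2 * (Real.cosh a - 1)) (k : ℕ)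
    (x : Fin (d + 1) → ℤ) (r : Fin (d + 1) → Fin n) :
    (((((LapS (fine n M) (n : ℂ) + 1)⁻¹) ^ k) *ᵥ fun t => ((∏ μ', Real.cosh (a * (circAbs (fine n M μ')
        ((bpt n M (toT M x) r μ' - t μ' : ZMod (fine n M μ')).val) : ℝ)) : ℝ) : ℂ)) (bpt n M (toT M x) r)).re
      ≤ ((1 - 2 * (d + 1) * (n : ℝ) ^ 2 * (Real.cosh a - 1))⁻¹) ^ k := by
  set c := bpt n M (toT M x) r with hc
  set W : Tor (fine n M) → ℝ := fun t =>
    ∏ μ', Real.cosh (a * (circAbs (fine n M μ') ((c μ' - t μ' : ZMod (fine n M μ')).val) : ℝ)) with hW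
  have hW0 : ∀ t, 0 ≤ W t := fun t => Finset.prod_nonneg fun _ _ => (Real.cosh_pos _).le
  have hΛ : ∀ t, ∑ ν, (W (t + unitVec (fine n M) ν) + W (t - unitVec (fine n M) ν))
      ≤ 2 * (d + 1) * Real.cosh a * W t := fun t => weight_stencil (fine n M) a c t
  have hlam' : 0 < 1 + (n : ℝ) ^ 2 * (2 * (d + 1) - 2 * (d + 1) * Real.cosh a) := by
    convert hlam using 1; ring
  have hWc : W c = 1 := by rw [hW]; exact weight_centre (fine n M) a c
  have h := re_inv_pow_mulVec_weight_le n M W hW0 hΛ hlam' k c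
  have e2 : 1 + (n : ℝ) ^ 2 * (2 * (d + 1) - 2 * (d + 1) * Real.cosh a)
      = 1 - 2 * (d + 1) * (n : ℝ) ^ 2 * (Real.cosh a - 1) := by ring
  rw [e2, hWc, mul_one] at h
  exact h

/-- **`Re (P_N W_c)(c) ≤ N λ_a^{−N}`** for the same weight (`0 < λ_a ≤ 1`). [folklore] -/
theorem re_resolventPoly_mulVec_cosh_le {a : ℝ} (hlam : 0 < 1 - 2 * (d + 1) * (n : ℝ) ^ 2 * (Real.cosh a - 1)) (Nn : ℕ)
    (x : Fin (d + 1) → ℤ) (r : Fin (d + 1) → Fin n) :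
    (((∑ k ∈ Finset.range Nn, ((LapS (fine n M) (n : ℂ) + 1)⁻¹) ^ (k + 1)) *ᵥ fun t => ((∏ μ', Real.cosh (a * (circAbs (fine n M μ')
        ((bpt n M (toT M x) r μ' - t μ' : ZMod (fine n M μ')).val) : ℝ)) : ℝ) : ℂ)) (bpt n M (toT M x) r)).re
      ≤ Nn * ((1 - 2 * (d + 1) * (n : ℝ) ^ 2 * (Real.cosh a - 1))⁻¹) ^ Nn := by
  set c := bpt n M (toT M x) r with hc
  set W : Tor (fine n M) → ℝ := fun t =>
    ∏ μ', Real.cosh (a * (circAbs (fine n M μ') ((c μ' - t μ' : ZMod (fine n M μ')).val) : ℝ)) with hW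
  have hW0 : ∀ t, 0 ≤ W t := fun t => Finset.prod_nonneg fun _ _ => (Real.cosh_pos _).le
  have hΛ : ∀ t, ∑ ν, (W (t + unitVec (fine n M) ν) + W (t - unitVec (fine n M) ν))
      ≤ 2 * (d + 1) * Real.cosh a * W t := fun t => weight_stencil (fine n M) a c t
  have hlam' : 0 < 1 + (n : ℝ) ^ 2 * (2 * (d + 1) - 2 * (d + 1) * Real.cosh a) := by
    convert hlam using 1; ring
  have hlam1 : 1 + (n : ℝ) ^ 2 * (2 * (d + 1) - 2 * (d + 1) * Real.cosh a) ≤ 1 := by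
    have h1 := Real.one_le_cosh a
    have h2 : (0 : ℝ) ≤ (n : ℝ) ^ 2 * (2 * (d + 1)) := by positivity
    nlinarith
  have hWc : W c = 1 := by rw [hW]; exact weight_centre (fine n M) a c
  have h := re_resolventPoly_mulVec_weight_le n M W hW0 hΛ hlam' hlam1 Nn c
  have e2 : 1 + (n : ℝ) ^ 2 * (2 * (d + 1) - 2 * (d + 1) * Real.cosh a)
      = 1 - 2 * (d + 1) * (n : ℝ) ^ 2 * (Real.cosh a - 1) := by ring
  rw [e2, hWc, mul_one] at h
  exact h

include hn in
/-- **`n`-UNIFORM BLOCK ROW SUMS OF `F^k`**: for `a ≥ 0` with `λ := 1 − 2(d+1) n² (cosh a − 1) > 0`,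
`Σ_{r′} |F^k(n x + r, n x′ + r′)| ≤ 2 λ^{−k} e^{a(n−1)} e^{−a n |x − x′|_∞}`. [folklore] -/
theorem inv_pow_block_rowsum_le {a : ℝ} (ha : 0 ≤ a)
    (hlam : 0 < 1 - 2 * (d + 1) * (n : ℝ) ^ 2 * (Real.cosh a - 1)) (k : ℕ)
    (x x' : Fin (d + 1) → ℤ) (r : Fin (d + 1) → Fin n) :
    ∑ r' : Fin (d + 1) → Fin n, ‖(((LapS (fine n M) (n : ℂ) + 1)⁻¹) ^ k) (bpt n M (toT M x) r) (bpt n M (toT M x') r')‖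
      ≤ 2 * ((1 - 2 * (d + 1) * (n : ℝ) ^ 2 * (Real.cosh a - 1))⁻¹) ^ k
          * Real.exp (a * ((n : ℝ) - 1)) * Real.exp (-(a * n * torusSupNorm M (x - x'))) :=
  block_rowsum_le_of_weight n hn M (((LapS (fine n M) (n : ℂ) + 1)⁻¹) ^ k) (inv_pow_apply_im_re n M k) ha x x' r
    (re_inv_pow_mulVec_cosh_le n M hlam k x r)

include hn in
/-- **`n`-UNIFORM BLOCK ROW SUMS OF `P_N = Σ_{k<N} F^{k+1}`**:
`Σ_{r′} |P_N(n x + r, n x′ + r′)| ≤ 2 N λ^{−N} e^{a(n−1)} e^{−a n |x − x′|_∞}` (scalar twin of pv15's `free_block_rowsum_le`). [folklore] -/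
theorem resolventPoly_block_rowsum_le {a : ℝ} (ha : 0 ≤ a)
    (hlam : 0 < 1 - 2 * (d + 1) * (n : ℝ) ^ 2 * (Real.cosh a - 1)) (Nn : ℕ)
    (x x' : Fin (d + 1) → ℤ) (r : Fin (d + 1) → Fin n) :
    ∑ r' : Fin (d + 1) → Fin n,
        ‖(∑ k ∈ Finset.range Nn, ((LapS (fine n M) (n : ℂ) + 1)⁻¹) ^ (k + 1)) (bpt n M (toT M x) r) (bpt n M (toT M x') r')‖
      ≤ 2 * (Nn * ((1 - 2 * (d + 1) * (n : ℝ) ^ 2 * (Real.cosh a - 1))⁻¹) ^ Nn)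
          * Real.exp (a * ((n : ℝ) - 1)) * Real.exp (-(a * n * torusSupNorm M (x - x'))) :=
  block_rowsum_le_of_weight n hn M _ (resolventPoly_apply_im_re n M Nn) ha x x' r
    (re_resolventPoly_mulVec_cosh_le n M hlam Nn x r)

end Block

end Summit.QuantumFields.BalabanUV.Beta.GAN24.ScalarFreeResolventRows

end
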